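import Summits.QuantumFields.YangMills.Theorems.BalabanUVNodesN19ExpectationCurrencyTwoConstants
import Mathlib.Analysis.Complex.Hadamard
import Mathlib.Analysis.SpecialFunctions.Arcosh
import Mathlib.Analysis.SpecialFunctions.Log.PosLog
import Literature.Barriers.CriticalPhenomena.RigorousRGSmallParameterFlowExponent

/-!
# YM-DAG node N19 (= NE7 proper) — THE OFF-WINDOW PRICE: NE7's source window is not load-bearing for bounded observables.
# cgf's `ε`-close on `|t| ≤ l₀` are `2e^{l₀B}·ε^{1 − 2·arcosh(|t|∕l₀)∕arcosh(1 + log⁺ε⁻¹∕(l₀B))}`-close at EVERY real source `t`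
# (Hadamard's three lines through the entire gauge `z ↦ l₀·cosh z`)

Cell `pub-ymgap`, HUMAN RULING D-0062 (Track A), R141 (C) wider-strategy seat `pub-ymgap-dag-n19-e` (strategy s3 = ALTERNATIVE CURRENCY), generation
g14, module 1.  Route `Summits/QuantumFields/YangMills/Theses/BalabanUVNodes.lean` rev 19, cluster item K3⁗ «SpineGivenEndpointR13Sep»
(stmt-QuantumFields-20292); filed `--supports` that item `--as helper` (it proves no registered stub).  COUNT-NEUTRAL: elementary complex analysis ∕
probability over Mathlib on top of the seat's module p480837 `…N19ExpectationCurrencyTwoConstants` BY NAME (`norm_complexMGF_sub_complexMGF_le`,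
`abs_mgf_sub_mgf_le_of_cgf_close`) and one real-analysis lemma of `Literature.Barriers.CriticalPhenomena.RigorousRGSmallParameterFlowExponent` (imported for
`abs_log_sub_log_le_div` only — nothing of that barrier is used); NOT a discharge claim.

THE QUESTION.  N19's DECL target `Spine.NE7.Target vol l₀ δ Z` (and `T4CauchySum.MatchingModConstants`) carries a SOURCE WINDOW `|t| ≤ l₀`.  p501027
`…N19TargetEverySource` typed the qualitative fact that for the scheme's dressed partition functions (cgf's of `[−1, 1]`-valued product observables) the
window is immaterial for CONVERGENCE: `Target` on one window gives convergence of the generating functions at every real source (E3 by name, no rate).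
HERE THE RATE.  For two probability spaces with observables `|X|, |Y| ≤ B` a.e. whose cgf's are `ε`-close on `|t| ≤ l₀`:
★★ `|mgf_Y(t) − mgf_X(t)| ≤ 2e^{l₀B}·ε^{1 − 2·arcosh(|t|∕l₀)∕arcosh(1 + log⁺ε⁻¹∕(l₀B))}` for `l₀ ≤ |t|`, `B(|t| − l₀) ≤ log⁺ε⁻¹` — at every FIXED source the
exponent tends to `1` as `ε → 0` (rate `ε^{1−o(1)}`), the loss being `≍ arcosh(|t|∕l₀)∕log log ε⁻¹` in the exponent.

THE MECHANISM (one step).  `f = complexMGF_Y − complexMGF_X` is ENTIRE OF EXPONENTIAL TYPE, `‖f z‖ ≤ 2e^{B‖z‖}` (`T4GenFunBounds` through p480837), and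
`‖f x‖ ≤ 2εe^{l₀B}` on the real window.  The entire gauge `z ↦ l₀·cosh z` maps the imaginary axis INTO the window (`cosh(iy) = cos y`), the closed strip
`0 ≤ re z ≤ V` into the disc `‖·‖ ≤ l₀·cosh V` (`‖cosh z‖ ≤ cosh(re z)`), and the real point `v` to `l₀·cosh v`.  Mathlib's Hadamard three-lines theorem
(`Complex.HadamardThreeLines.norm_le_interp_of_mem_verticalClosedStrip'`) for `f ∘ (l₀·cosh)` on that strip gives §1:
`‖f(±l₀cosh v)‖ ≤ m^{1−v∕V}·M^{v∕V}` from `‖f‖ ≤ M` on the disc `‖z‖ ≤ l₀cosh V` and `‖f x‖ ≤ m` on the real window.  §2 takes `M = 2e^{l₀B·cosh V}`,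
`m = 2εe^{l₀B}` and the strip height with `l₀B·cosh V = l₀B + log⁺ε⁻¹` (so that `M = m∕ε²`), whence the displayed exponent `1 − 2v∕V`.

KERNEL-CHECKED (0 `def`, 0 `sorry`): §1 [folklore] `norm_le_interp_of_short_segment_cosh` (at `l₀cosh v`), ★ `norm_le_interp_of_short_segment` (at any real
`t`, `l₀ ≤ |t|`, `arcosh(|t|∕l₀) ≤ V`) · §2 [folklore] `abs_mgf_sub_mgf_le_offWindow_gauge` (every strip height `V`), ★★ `abs_mgf_sub_mgf_le_offWindow`,
★ `abs_cgf_sub_cgf_le_offWindow` (cgf face, one more factor `e^{|t|B}`; the `a⁻¹`-Lipschitz bound for `log` on `[a, ∞)` is the tree's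
`Literature.Barriers.CriticalPhenomena.LongRangePhi4.abs_log_sub_log_le_div`, imported — gate dedup, not restated).
The scheme faces (window ENLARGEMENT of `MatchingModConstants` ∕ `Target`) are the sibling `…Theorems.BalabanUVNodesN19OffWindowPriceAtScheme`.

NOT CLAIMED: optimality of the constant `2` in the exponent's correction (the grid-Chebyshev pairs of p510514 give the matching LOWER shape
`ε·cosh(M·arcosh(|t|∕l₀))` with `log ε⁻¹ ≤ M·log(1 + 4M∕l₀)`, i.e. exponent `1 − Θ(arcosh(|t|∕l₀)∕log log ε⁻¹)` two-sided — not typed in this module);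
nothing for `|t| − l₀ > log⁺ε⁻¹∕B` beyond the trivial `2e^{|t|B}`.

HONEST FRAMING (binding).  Elementary; NO consumer in the DAG today (the apex consumes existence of limits); located future use: a producer delivering N19's
`Target` on a window SMALLER than the record's reaches every window by the sibling's enlargement lemma (geometric remainders).  Nothing of
[Balaban1987RG1]–[Balaban1989LargeFieldII] or [King1986] is asserted, quoted or instantiated; NE7 ∕ NE7b ∕ NE7c NOT PRINTED, NOT proved; N19 NOT discharged;
Track A count unmoved (typed 28∕28 · discharged 5∕27 · A 5∕28).  One finite `T⁴` programme at fixed `ε`; nothing continuum ∕ `ℝ⁴` ∕ OS ∕ mass-gap ∕ Clay.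
THEOREMS ONLY; standard axioms; no decl carries a cite tag (Hadamard's three-lines theorem is Mathlib's, used by name).
-/

set_option autoImplicit false

noncomputable section

open Set Metric Filter Topology MeasureTheory ProbabilityTheory Complex
open scoped BigOperators

namespace Summit.QuantumFields.YangMills.Theorems.BalabanUVNodesN19OffWindowPrice

open Literature.MathematicalPhysics.QuantumFieldTheory.Balaban1983to89
open Summit.QuantumFields.YangMills.BalabanUVNodes.N19ExpectationCurrencyTwoConstants
  (norm_complexMGF_sub_complexMGF_le abs_mgf_sub_mgf_le_of_cgf_close)
open Complex.HadamardThreeLines (verticalStrip verticalClosedStrip norm_le_interp_of_mem_verticalClosedStrip')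

/-! ## §1 Complex analysis: three lines with smallness on a SHORT real segment, read OFF the segment along the real axis [folklore] -/

section Complex

variable {E : Type*} [NormedAddCommGroup E] [NormedSpace ℂ E]

/-- **Off-segment two constants, `cosh` form.**  `f` entire, `‖f z‖ ≤ M` on the disc `‖z‖ ≤ l₀·cosh V`, `‖f x‖ ≤ m` for real `|x| ≤ l₀` (`0 < l₀`, `0 < V`);
then at the real point `l₀·cosh v`, `0 ≤ v ≤ V`: `‖f(l₀cosh v)‖ ≤ m^{1−v∕V}·M^{v∕V}` — Mathlib's Hadamard three-lines theorem on the strip `0 ≤ re z ≤ V`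
for `f ∘ (l₀·cosh)`: the imaginary axis goes INTO the real window (`cosh(iy) = cos y`), the whole closed strip into the disc (`‖cosh z‖ ≤ cosh(re z) ≤ cosh V`).
[folklore] -/
theorem norm_le_interp_of_short_segment_cosh {f : ℂ → E} {m M l₀ V v : ℝ} (hl₀ : 0 < l₀) (hV : 0 < V) (hv0 : 0 ≤ v) (hvV : v ≤ V)
    (hf : Differentiable ℂ f) (hM : ∀ z : ℂ, ‖z‖ ≤ l₀ * Real.cosh V → ‖f z‖ ≤ M) (hm : ∀ x : ℝ, |x| ≤ l₀ → ‖f x‖ ≤ m) :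
    ‖f (l₀ * Real.cosh v : ℝ)‖ ≤ m ^ (1 - v / V) * M ^ (v / V) := by
  -- `‖cosh w‖ ≤ cosh (re w)`
  have hcosh : ∀ w : ℂ, ‖Complex.cosh w‖ ≤ Real.cosh w.re := fun w => by
    rw [Complex.cosh, Real.cosh_eq, norm_div, Complex.norm_ofNat]
    gcongr
    calc ‖Complex.exp w + Complex.exp (-w)‖ ≤ ‖Complex.exp w‖ + ‖Complex.exp (-w)‖ := norm_add_le _ _
      _ = Real.exp w.re + Real.exp (-w.re) := by rw [Complex.norm_exp, Complex.norm_exp, Complex.neg_re]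
  -- the gauge and the composite
  set g : ℂ → E := fun w => f ((l₀ : ℂ) * Complex.cosh w) with hg
  have hgd : Differentiable ℂ g := hf.comp (Complex.differentiable_cosh.const_mul (l₀ : ℂ))
  -- the closed strip goes into the disc `‖z‖ ≤ l₀ cosh V`
  have hstrip : ∀ w : ℂ, w ∈ verticalClosedStrip 0 V → ‖g w‖ ≤ M := fun w hw => by
    simp only [verticalClosedStrip, mem_preimage, mem_Icc] at hw
    refine hM _ ?_
    rw [norm_mul, Complex.norm_real, Real.norm_eq_abs, abs_of_pos hl₀]
    refine mul_le_mul_of_nonneg_left ((hcosh w).trans (Real.cosh_le_cosh.2 ?_)) hl₀.le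
    rw [abs_of_nonneg hw.1, abs_of_pos hV]
    exact hw.2
  have hB : BddAbove ((norm ∘ g) '' verticalClosedStrip 0 V) := by
    refine ⟨M, ?_⟩
    rintro _ ⟨w, hw, rfl⟩
    exact hstrip w hw
  -- the imaginary axis goes into the real window
  have ha : ∀ w ∈ re ⁻¹' ({0} : Set ℝ), ‖g w‖ ≤ m := fun w hw => by
    simp only [mem_preimage, mem_singleton_iff] at hw
    have hw' : w = (w.im : ℂ) * I := by
      apply Complex.ext <;> simp [hw]
    have hcw : Complex.cosh w = Complex.cos (w.im : ℂ) := by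
      conv_lhs => rw [hw']
      exact Complex.cosh_mul_I _
    have hcos : (l₀ : ℂ) * Complex.cosh w = ((l₀ * Real.cos w.im : ℝ) : ℂ) := by
      rw [hcw]
      push_cast
      rfl
    show ‖f ((l₀ : ℂ) * Complex.cosh w)‖ ≤ m
    rw [hcos]
    refine hm _ ?_
    rw [abs_mul, abs_of_pos hl₀]
    exact mul_le_of_le_one_right hl₀.le (Real.abs_cos_le_one _)
  have hb : ∀ w ∈ re ⁻¹' ({V} : Set ℝ), ‖g w‖ ≤ M := fun w hw => by
    simp only [mem_preimage, mem_singleton_iff] at hw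
    exact hstrip w (by simp [verticalClosedStrip, hw, hV.le])
  have hz : ((v : ℝ) : ℂ) ∈ verticalClosedStrip 0 V := by
    simp [verticalClosedStrip, hv0, hvV]
  have key := norm_le_interp_of_mem_verticalClosedStrip' hV hz hgd.diffContOnCl hB ha hb
  simp only [Complex.ofReal_re, sub_zero] at key
  have hgv : g (v : ℂ) = f (l₀ * Real.cosh v : ℝ) := by
    show f ((l₀ : ℂ) * Complex.cosh (v : ℂ)) = f (l₀ * Real.cosh v : ℝ)
    push_cast
    rfl
  rw [hgv] at key
  exact key

/-- **Off-segment two constants at a real point.**  Same hypotheses (symmetric in `z ↦ −z`); at any real `t` with `l₀ ≤ |t|` and `arcosh(|t|∕l₀) ≤ V`: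
`‖f t‖ ≤ m^{1−s}·M^{s}`, `s = arcosh(|t|∕l₀)∕V` (`t = ±l₀cosh v`; the `−` sign through `f ∘ neg`). [folklore] -/
theorem norm_le_interp_of_short_segment {f : ℂ → E} {m M l₀ V : ℝ} {t : ℝ} (hl₀ : 0 < l₀) (hV : 0 < V)
    (hf : Differentiable ℂ f) (hM : ∀ z : ℂ, ‖z‖ ≤ l₀ * Real.cosh V → ‖f z‖ ≤ M) (hm : ∀ x : ℝ, |x| ≤ l₀ → ‖f x‖ ≤ m)
    (hl : l₀ ≤ |t|) (htV : Real.arcosh (|t| / l₀) ≤ V) :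
    ‖f t‖ ≤ m ^ (1 - Real.arcosh (|t| / l₀) / V) * M ^ (Real.arcosh (|t| / l₀) / V) := by
  set v : ℝ := Real.arcosh (|t| / l₀) with hv
  have h1 : 1 ≤ |t| / l₀ := by rwa [le_div_iff₀ hl₀, one_mul]
  have hv0 : 0 ≤ v := Real.arcosh_nonneg h1
  have hcv : l₀ * Real.cosh v = |t| := by
    rw [hv, Real.cosh_arcosh h1, mul_div_cancel₀ _ hl₀.ne']
  rcases le_or_gt 0 t with ht | ht
  · have e : (t : ℂ) = ((l₀ * Real.cosh v : ℝ) : ℂ) := by rw [hcv, abs_of_nonneg ht]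
    rw [e]
    exact norm_le_interp_of_short_segment_cosh hl₀ hV hv0 htV hf hM hm
  · -- `t < 0`: apply the `cosh` form to `f ∘ neg`
    have hf' : Differentiable ℂ (fun z : ℂ => f (-z)) := hf.comp differentiable_neg
    have hM' : ∀ z : ℂ, ‖z‖ ≤ l₀ * Real.cosh V → ‖f (-z)‖ ≤ M := fun z hz => hM _ (by rwa [norm_neg])
    have hm' : ∀ x : ℝ, |x| ≤ l₀ → ‖(fun z : ℂ => f (-z)) x‖ ≤ m := fun x hx => by
      show ‖f (-(x : ℂ))‖ ≤ m
      rw [← Complex.ofReal_neg]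
      exact hm _ (by rwa [abs_neg])
    have key := norm_le_interp_of_short_segment_cosh hl₀ hV hv0 htV hf' hM' hm'
    have e : -(((l₀ * Real.cosh v : ℝ)) : ℂ) = (t : ℂ) := by
      rw [hcv, abs_of_neg ht]
      push_cast
      ring
    simpa only [e] using key

end Complex

/-! ## §2 Two probability spaces: the off-window price [folklore] -/

section MGF

variable {Ω Ω' : Type*} [MeasurableSpace Ω] [MeasurableSpace Ω'] {μ : Measure Ω} {ν : Measure Ω'}
  [IsProbabilityMeasure μ] [IsProbabilityMeasure ν] {X : Ω → ℝ} {Y : Ω' → ℝ} {B : ℝ}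

/-- **GAUGE FORM (every strip height `V`).**  Two probability spaces, observables `|X|, |Y| ≤ B` a.e.; if `|cgf_Y(s) − cgf_X(s)| ≤ ε` for every real
`|s| ≤ l₀` (`0 < l₀`), then at every real `t` with `l₀ ≤ |t|` and `arcosh(|t|∕l₀) ≤ V` (`0 < V`):
`|mgf_Y(t) − mgf_X(t)| ≤ (2εe^{l₀B})^{1−s}·(2e^{l₀B·cosh V})^{s}`, `s = arcosh(|t|∕l₀)∕V` — §1 for the entire `complexMGF Y ν − complexMGF X μ`
(`≤ 2e^{‖z‖B}` everywhere, `≤ 2εe^{l₀B}` on the window). [folklore] -/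
theorem abs_mgf_sub_mgf_le_offWindow_gauge (hX : AEMeasurable X μ) (hY : AEMeasurable Y ν)
    (hXB : ∀ᵐ ω ∂μ, |X ω| ≤ B) (hYB : ∀ᵐ ω ∂ν, |Y ω| ≤ B) {ε l₀ V t : ℝ} (hl₀ : 0 < l₀) (hV : 0 < V)
    (hε : ∀ s : ℝ, |s| ≤ l₀ → |cgf Y ν s - cgf X μ s| ≤ ε) (hl : l₀ ≤ |t|) (htV : Real.arcosh (|t| / l₀) ≤ V) :
    |mgf Y ν t - mgf X μ t| ≤
      (2 * ε * Real.exp (l₀ * B)) ^ (1 - Real.arcosh (|t| / l₀) / V) *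
        (2 * Real.exp (l₀ * Real.cosh V * B)) ^ (Real.arcosh (|t| / l₀) / V) := by
  have hB0 : 0 ≤ B := T4GenFunBounds.nonneg_of_ae_abs_le (IsProbabilityMeasure.ne_zero μ) hXB
  set f : ℂ → ℂ := fun z => complexMGF Y ν z - complexMGF X μ z with hf
  have hfd : Differentiable ℂ f :=
    (T4GenFunBounds.differentiable_complexMGF_of_abs_le hY hYB).sub (T4GenFunBounds.differentiable_complexMGF_of_abs_le hX hXB)
  have hM : ∀ z : ℂ, ‖z‖ ≤ l₀ * Real.cosh V → ‖f z‖ ≤ 2 * Real.exp (l₀ * Real.cosh V * B) := fun z hz => by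
    refine (norm_complexMGF_sub_complexMGF_le hXB hYB z).trans ?_
    gcongr
  have hm : ∀ x : ℝ, |x| ≤ l₀ → ‖f x‖ ≤ 2 * ε * Real.exp (l₀ * B) := fun x hx => by
    show ‖complexMGF Y ν x - complexMGF X μ x‖ ≤ _
    rw [complexMGF_ofReal, complexMGF_ofReal, ← Complex.ofReal_sub, Complex.norm_real, Real.norm_eq_abs]
    have hε0 : 0 ≤ ε := (abs_nonneg _).trans (hε x hx)
    exact (abs_mgf_sub_mgf_le_of_cgf_close hX hY hXB hYB (hε x hx)).trans (by gcongr)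
  have key := norm_le_interp_of_short_segment hl₀ hV hfd hM hm hl htV
  have hft : f t = ((mgf Y ν t - mgf X μ t : ℝ) : ℂ) := by
    show complexMGF Y ν t - complexMGF X μ t = _
    rw [complexMGF_ofReal, complexMGF_ofReal, Complex.ofReal_sub]
  rwa [hft, Complex.norm_real, Real.norm_eq_abs] at key

/-- **THE OFF-WINDOW PRICE.**  Two probability spaces, observables `|X|, |Y| ≤ B` a.e. (`0 < B`), cgf's `ε`-close on the window `|s| ≤ l₀` (`0 < l₀`,
`0 ≤ ε`); then at every real `t` with `l₀ ≤ |t|` and `B·(|t| − l₀) ≤ log⁺ε⁻¹`: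
`|mgf_Y(t) − mgf_X(t)| ≤ 2e^{l₀B}·ε^{1 − 2·arcosh(|t|∕l₀)∕arcosh(1 + log⁺ε⁻¹∕(l₀B))}` — the gauge form at the strip height `V` with
`l₀B·cosh V = l₀B + log⁺ε⁻¹`.  At a fixed source the exponent tends to `1` as `ε → 0`. [folklore] -/
theorem abs_mgf_sub_mgf_le_offWindow (hX : AEMeasurable X μ) (hY : AEMeasurable Y ν)
    (hXB : ∀ᵐ ω ∂μ, |X ω| ≤ B) (hYB : ∀ᵐ ω ∂ν, |Y ω| ≤ B) {ε l₀ t : ℝ} (hl₀ : 0 < l₀) (hB : 0 < B) (hε0 : 0 ≤ ε)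
    (hε : ∀ s : ℝ, |s| ≤ l₀ → |cgf Y ν s - cgf X μ s| ≤ ε) (hl : l₀ ≤ |t|) (hL : B * (|t| - l₀) ≤ Real.posLog ε⁻¹) :
    |mgf Y ν t - mgf X μ t| ≤
      2 * Real.exp (l₀ * B) * ε ^ (1 - 2 * Real.arcosh (|t| / l₀) / Real.arcosh (1 + Real.posLog ε⁻¹ / (l₀ * B))) := by
  set L : ℝ := Real.posLog ε⁻¹ with hLdef
  have hL0 : 0 ≤ L := Real.posLog_nonneg
  rcases hL0.eq_or_lt with hL00 | hLpos
  · -- `log⁺ ε⁻¹ = 0`: then `|t| = l₀`, inside the window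
    have htl : |t| = l₀ := by
      refine le_antisymm ?_ hl
      have : B * (|t| - l₀) ≤ 0 := by rw [hL00]; exact hL
      nlinarith
    have h0 : Real.arcosh (|t| / l₀) = 0 := by rw [htl, div_self hl₀.ne', Real.arcosh_zero]
    rw [h0, mul_zero, zero_div, sub_zero, Real.rpow_one]
    calc |mgf Y ν t - mgf X μ t| ≤ 2 * ε * Real.exp (|t| * B) :=
          abs_mgf_sub_mgf_le_of_cgf_close hX hY hXB hYB (hε t htl.le)
      _ = 2 * Real.exp (l₀ * B) * ε := by rw [htl]; ring
  · -- `0 < log⁺ ε⁻¹`: so `0 < ε < 1` and `e^{L} = ε⁻¹`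
    have hε1 : 1 < ε⁻¹ := by
      refine lt_of_not_ge fun h => ?_
      have : Real.posLog ε⁻¹ = 0 := (Real.posLog_eq_zero_iff _).2 (by rw [abs_of_nonneg (inv_nonneg.2 hε0)]; exact h)
      exact hLpos.ne' (by rw [hLdef, this])
    have hεpos : 0 < ε := by
      refine lt_of_not_ge fun h => ?_
      have : ε = 0 := le_antisymm h hε0
      rw [this, inv_zero] at hε1
      linarith
    have hLlog : L = Real.log ε⁻¹ := by
      rw [hLdef, Real.posLog_eq_log (by rw [abs_of_pos (inv_pos.2 hεpos)]; exact hε1.le)]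
    have hexpL : Real.exp L = ε⁻¹ := by rw [hLlog, Real.exp_log (inv_pos.2 hεpos)]
    -- the strip height
    have hc1 : 1 < 1 + L / (l₀ * B) := lt_add_of_pos_right _ (div_pos hLpos (mul_pos hl₀ hB))
    set V : ℝ := Real.arcosh (1 + L / (l₀ * B)) with hVdef
    have hV : 0 < V := Real.arcosh_pos hc1
    have hcoshV : Real.cosh V = 1 + L / (l₀ * B) := Real.cosh_arcosh hc1.le
    have htV : Real.arcosh (|t| / l₀) ≤ V := by
      rw [hVdef, Real.arcosh_le_arcosh (div_pos (hl₀.trans_le hl) hl₀) (by linarith)]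
      rw [div_le_iff₀ hl₀]
      have e : L / (l₀ * B) * l₀ = L / B := by
        rw [mul_comm l₀ B]
        calc L / (B * l₀) * l₀ = L * l₀ / (B * l₀) := by ring
          _ = L / B := mul_div_mul_right L B hl₀.ne'
      have h' : |t| - l₀ ≤ L / B := by
        rw [le_div_iff₀ hB, mul_comm]
        exact hL
      rw [add_mul, one_mul, e]
      linarith
    have key := abs_mgf_sub_mgf_le_offWindow_gauge hX hY hXB hYB hl₀ hV hε hl htV
    -- rewrite the two bases: `2εe^{l₀B}` and `2e^{l₀B cosh V} = 2e^{l₀B}·ε⁻¹`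
    set s : ℝ := Real.arcosh (|t| / l₀) / V with hs
    have hexp_arg : l₀ * Real.cosh V * B = l₀ * B + L := by
      rw [hcoshV, mul_add, add_mul, mul_one]
      congr 1
      calc l₀ * (L / (l₀ * B)) * B = L * (l₀ * B) / (l₀ * B) := by ring
        _ = L := mul_div_cancel_right₀ L (mul_ne_zero hl₀.ne' hB.ne')
    have hbase : 2 * Real.exp (l₀ * Real.cosh V * B) = 2 * Real.exp (l₀ * B) * ε⁻¹ := by
      rw [hexp_arg, Real.exp_add, hexpL]
      ring
    rw [hbase] at key
    have hA : 0 < 2 * Real.exp (l₀ * B) := by positivity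
    have e1 : (2 * ε * Real.exp (l₀ * B)) ^ (1 - s) = (2 * Real.exp (l₀ * B)) ^ (1 - s) * ε ^ (1 - s) := by
      rw [show 2 * ε * Real.exp (l₀ * B) = 2 * Real.exp (l₀ * B) * ε by ring]
      exact Real.mul_rpow hA.le hεpos.le
    have e2 : (2 * Real.exp (l₀ * B) * ε⁻¹) ^ s = (2 * Real.exp (l₀ * B)) ^ s * ε ^ (-s) := by
      rw [Real.mul_rpow hA.le (inv_nonneg.2 hεpos.le), Real.rpow_neg hεpos.le, Real.inv_rpow hεpos.le]
    have e3 : (2 * Real.exp (l₀ * B)) ^ (1 - s) * (2 * Real.exp (l₀ * B)) ^ s = 2 * Real.exp (l₀ * B) := by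
      rw [← Real.rpow_add hA, sub_add_cancel, Real.rpow_one]
    have e4 : ε ^ (1 - s) * ε ^ (-s) = ε ^ (1 - 2 * Real.arcosh (|t| / l₀) / V) := by
      rw [← Real.rpow_add hεpos]
      congr 1
      rw [hs]
      ring
    calc |mgf Y ν t - mgf X μ t| ≤ (2 * ε * Real.exp (l₀ * B)) ^ (1 - s) * (2 * Real.exp (l₀ * B) * ε⁻¹) ^ s := key
      _ = ((2 * Real.exp (l₀ * B)) ^ (1 - s) * (2 * Real.exp (l₀ * B)) ^ s) * (ε ^ (1 - s) * ε ^ (-s)) := by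
          rw [e1, e2]; ring
      _ = 2 * Real.exp (l₀ * B) * ε ^ (1 - 2 * Real.arcosh (|t| / l₀) / V) := by rw [e3, e4]

/-- **THE OFF-WINDOW PRICE, cgf face.**  Same hypotheses; then
`|cgf_Y(t) − cgf_X(t)| ≤ 2e^{(l₀+|t|)B}·ε^{1 − 2·arcosh(|t|∕l₀)∕arcosh(1 + log⁺ε⁻¹∕(l₀B))}` (both mgf's are `≥ e^{−|t|B}`, where `log` is
`e^{|t|B}`-Lipschitz). [folklore] -/
theorem abs_cgf_sub_cgf_le_offWindow (hX : AEMeasurable X μ) (hY : AEMeasurable Y ν)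
    (hXB : ∀ᵐ ω ∂μ, |X ω| ≤ B) (hYB : ∀ᵐ ω ∂ν, |Y ω| ≤ B) {ε l₀ t : ℝ} (hl₀ : 0 < l₀) (hB : 0 < B) (hε0 : 0 ≤ ε)
    (hε : ∀ s : ℝ, |s| ≤ l₀ → |cgf Y ν s - cgf X μ s| ≤ ε) (hl : l₀ ≤ |t|) (hL : B * (|t| - l₀) ≤ Real.posLog ε⁻¹) :
    |cgf Y ν t - cgf X μ t| ≤
      2 * Real.exp ((l₀ + |t|) * B) * ε ^ (1 - 2 * Real.arcosh (|t| / l₀) / Real.arcosh (1 + Real.posLog ε⁻¹ / (l₀ * B))) := by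
  have hmX : Real.exp (-(|t| * B)) ≤ mgf X μ t := by
    have h := T4GenFunBounds.exp_neg_le_mgf_of_abs_le hX hXB t; rwa [probReal_univ, one_mul] at h
  have hmY : Real.exp (-(|t| * B)) ≤ mgf Y ν t := by
    have h := T4GenFunBounds.exp_neg_le_mgf_of_abs_le hY hYB t; rwa [probReal_univ, one_mul] at h
  have hlog := Literature.Barriers.CriticalPhenomena.LongRangePhi4.abs_log_sub_log_le_div (Real.exp_pos (-(|t| * B))) hmY hmX
  have key := abs_mgf_sub_mgf_le_offWindow hX hY hXB hYB hl₀ hB hε0 hε hl hL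
  rw [cgf, cgf]
  refine hlog.trans ?_
  rw [div_le_iff₀ (Real.exp_pos _)]
  refine key.trans (le_of_eq ?_)
  rw [show (l₀ + |t|) * B = l₀ * B + |t| * B by ring, Real.exp_add]
  have : Real.exp (|t| * B) * Real.exp (-(|t| * B)) = 1 := by rw [← Real.exp_add, add_neg_cancel, Real.exp_zero]
  calc 2 * Real.exp (l₀ * B) * ε ^ (1 - 2 * Real.arcosh (|t| / l₀) / Real.arcosh (1 + Real.posLog ε⁻¹ / (l₀ * B)))
      = 2 * Real.exp (l₀ * B) * ε ^ (1 - 2 * Real.arcosh (|t| / l₀) / Real.arcosh (1 + Real.posLog ε⁻¹ / (l₀ * B))) *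
          (Real.exp (|t| * B) * Real.exp (-(|t| * B))) := by rw [this, mul_one]
    _ = 2 * (Real.exp (l₀ * B) * Real.exp (|t| * B)) *
          ε ^ (1 - 2 * Real.arcosh (|t| / l₀) / Real.arcosh (1 + Real.posLog ε⁻¹ / (l₀ * B))) * Real.exp (-(|t| * B)) := by ring

end MGF

end Summit.QuantumFields.YangMills.Theorems.BalabanUVNodesN19OffWindowPrice

end
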